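import Mathlib
import Literature.NumberTheory.Sieve.LinearEquationsInPrimesCountSandwich
import Literature.NumberTheory.Sieve.LinearEquationsInPrimesCountDeduction
import Literature.NumberTheory.Sieve.PolynomialValuesSieveBounds
import Literature.NumberTheory.LFunctions.HuxleyZeroDensity
import HarnessLib

/-!
# Uniform upper bound for `∑_K ∏ Λ(ψᵢ n)` (crux `TwinLowerDensityToGHL`, stmt-Parity-18380): preliminaries

Elementary, Literature-only preliminaries for the uniform Brun–Titchmarsh bound of
`Theorems/TwinLowerDensityToGHLUniformUpperBound.lean` (the unconditional UPPER-HALF rung of the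
conclusion of the registered stub `stub_shiftLift` / of `GeneralizedHardyLittlewoodDimOne`, up to the sieve
constant).  For a non-degenerate one-dimensional system `Ψ` of `t ≥ 1` forms with `‖Ψ‖_N ≤ L` and any
`K`, with the ROUGH POINTS
`R_Y = {n ∈ [-N, N] : (n) ∈ K, P⁻(ψᵢ(n)) > Y ∀ i}` (written out as a `Finset.filter`, no definition):

* `primePointCount_le_card_rough_add` — `#{prime points of K} ≤ #R_Y + t (2Y + 1)` (a prime point whose
  values all exceed `Y` is rough; otherwise some `|ψᵢ(n)| ≤ Y`, at most `2Y + 1` points per form, tree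
  `card_filter_abs_eval_le`);
* `vonMangoldtSum_le_card_rough` — with the tree's sandwich `vonMangoldtSum_primePointCount_sandwich`:
  `∑_K ∏ Λ(ψᵢ n) ≤ log^t(2LN) · (#R_Y + 2t(2Y + 1) + t √(2LN) log₂(2LN))`;
* `sum_rootCount_le_sq` — the crude remainder bound `∑_{d ≤ D sqfree} ω_F(d) ≤ ⌊D⌋²` (`ω_F(d) ≤ d`);
* `upper_assembly` — the real-arithmetic assembly of the sieve main term
  (`#I ≤ β_∞ + 1`, `V ≤ 1`, `V ≤ 2 𝔖 W^t`, `b W ≤ 34` ⇒ `b^t · ((1+C) #I V) ≤ 2(1+C) 34^t β_∞𝔖 + (1+C) b^t`);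
* `eventually_junk_le` — all junk terms are `≤ ε N` for large `N`
  (`log^t(2LN) · ((1+C) + ⌊N^{1/8}⌋² + 2t(2N^{1/17}+1) + t √(2LN) log₂(2LN)) = O((log N)^{t+1} √N)`).

References: B. Green, T. Tao, *Linear equations in primes*, Ann. of Math. 171 (2010), §1 (sketch proof of
Conj. 1.4) [GreenTao2010]; H. Halberstam, H.-E. Richert, *Sieve Methods* (1974), Thm. 2.2 and §5.7
[HalberstamRichert1974].
-/

open Finset Filter
open scoped Classical

namespace Summit.Parity.GeneralizedHardyLittlewood.TwinLowerDensityToGHLUniformUpperBound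

open Literature.NumberTheory.Sieve

variable {t : ℕ}

/-! ### Prime points versus rough points -/

/-- **Prime points are rough or have a small value**: for `Y ≥ 0`,
`#{n ∈ K ∩ [-N,N] : ψᵢ(n) prime ∀ i} ≤ #{n ∈ K ∩ [-N,N] : P⁻(ψᵢ(n)) > Y ∀ i} + t (2Y + 1)`.
[cite: GreenTao2010, Conj. 1.4 (sketch proof)] -/
theorem primePointCount_le_card_rough_add {N : ℕ} (Ψ : Fin t → AffLinForm 1)
    (hΨ : IsNondegenerateSystem Ψ) (K : Set (Fin 1 → ℝ)) {Y : ℝ} (hY : 0 ≤ Y) :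
    (primePointCount Ψ K N : ℝ) ≤
      #((latticeBox 1 N).filter (fun n => realPoint n ∈ K ∧
          ∀ i, Y < (Nat.minFac ((Ψ i).eval n).toNat : ℝ))) + t * (2 * Y + 1) := by
  classical
  set KB : Finset (Fin 1 → ℤ) := (latticeBox 1 N).filter fun n => realPoint n ∈ K with hKB
  have hKBsub : KB ⊆ latticeBox 1 N := Finset.filter_subset _ _
  set R : Finset (Fin 1 → ℤ) := (latticeBox 1 N).filter (fun n => realPoint n ∈ K ∧
    ∀ i, Y < (Nat.minFac ((Ψ i).eval n).toNat : ℝ)) with hR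
  set B : Finset (Fin 1 → ℤ) := Finset.univ.biUnion fun i : Fin t =>
    KB.filter fun n => |((Ψ i).eval n : ℝ)| ≤ Y with hB
  have hP : primePointCount Ψ K N =
      #((latticeBox 1 N).filter fun n => realPoint n ∈ K ∧ ∀ i, ((Ψ i).eval n).toNat.Prime) := rfl
  have hsub : ((latticeBox 1 N).filter fun n => realPoint n ∈ K ∧ ∀ i, ((Ψ i).eval n).toNat.Prime) ⊆
      R ∪ B := by
    intro n hn
    rw [Finset.mem_filter] at hn
    obtain ⟨hbox, hK, hpr⟩ := hn
    rw [Finset.mem_union]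
    by_cases hbig : ∀ i, Y < ((Ψ i).eval n : ℝ)
    · left
      rw [hR, Finset.mem_filter]
      refine ⟨hbox, hK, fun i => ?_⟩
      have hp := hpr i
      rw [hp.minFac_eq, cast_toNat_of_two_le hp.two_le]
      exact hbig i
    · right
      obtain ⟨i, hi⟩ := not_forall.mp hbig
      have hle : ((Ψ i).eval n : ℝ) ≤ Y := le_of_not_gt hi
      have h2 := (hpr i).two_le
      have h0 : (0 : ℝ) ≤ ((Ψ i).eval n : ℝ) := by
        have : (0 : ℤ) ≤ (Ψ i).eval n := by omega
        exact_mod_cast this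
      rw [hB, Finset.mem_biUnion]
      refine ⟨i, Finset.mem_univ i, Finset.mem_filter.mpr ⟨?_, ?_⟩⟩
      · rw [hKB, Finset.mem_filter]; exact ⟨hbox, hK⟩
      · rw [abs_of_nonneg h0]; exact hle
  have hBcard : (#B : ℝ) ≤ t * (2 * Y + 1) := by
    calc (#B : ℝ) ≤ ∑ i : Fin t, (#(KB.filter fun n => |((Ψ i).eval n : ℝ)| ≤ Y) : ℝ) := by
          rw [hB]; exact_mod_cast Finset.card_biUnion_le
      _ ≤ ∑ _i : Fin t, (2 * Y + 1) * (2 * N + 1) ^ (1 - 1) :=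
          Finset.sum_le_sum fun i _ => card_filter_abs_eval_le hY (Ψ i) (hΨ.1 i) KB hKBsub
      _ = t * (2 * Y + 1) := by
          rw [Finset.sum_const, Finset.card_univ, Fintype.card_fin, nsmul_eq_mul]; ring
  calc (primePointCount Ψ K N : ℝ) ≤ (#(R ∪ B) : ℝ) := by
        rw [hP]; exact_mod_cast Finset.card_le_card hsub
    _ ≤ #R + #B := by exact_mod_cast Finset.card_union_le _ _
    _ ≤ #R + t * (2 * Y + 1) := by linarith

/-- **The von Mangoldt sum against the rough points**: for `N ≥ 1`, `t ≥ 1`, `‖Ψ‖_N ≤ L`, `Y ≥ 1`,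
`∑_K ∏ Λ(ψᵢ n) ≤ log^t(2LN) · (#R_Y + 2t(2Y+1) + t √(2LN) log₂(2LN))` (tree sandwich: each term is
`≤ log^t(2LN)`; the support consists of prime points, points with a value `≤ Y`, and points with a higher
prime-power value). [cite: GreenTao2010, Conj. 1.4 (sketch proof)] -/
theorem vonMangoldtSum_le_card_rough {N L : ℕ} (hN : 1 ≤ N) (Ψ : Fin t → AffLinForm 1)
    (hΨ : IsNondegenerateSystem Ψ) (hL : affLinSize Ψ N ≤ L) (K : Set (Fin 1 → ℝ)) (ht : 1 ≤ t)
    {Y : ℝ} (hY : 1 ≤ Y) :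
    vonMangoldtSum Ψ K N ≤ Real.log (2 * L * N) ^ t *
      (#((latticeBox 1 N).filter (fun n => realPoint n ∈ K ∧
          ∀ i, Y < (Nat.minFac ((Ψ i).eval n).toNat : ℝ))) + 2 * t * (2 * Y + 1) +
        t * ((Nat.sqrt (2 * L * N) : ℝ) * (Nat.log 2 (2 * L * N) : ℝ))) := by
  obtain ⟨g, β, γ, hg0, hβ0, hγ0, -, hS, hgP, -, hβ, hγ⟩ :=
    vonMangoldtSum_primePointCount_sandwich (a := 0) (b := Real.log (2 * L * N)) hN Ψ hΨ hL K ht hY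
      le_rfl (Real.log_nonneg hY) le_rfl
  have hP := primePointCount_le_card_rough_add (N := N) Ψ hΨ K (by linarith : (0 : ℝ) ≤ Y)
  have hL1 : (1 : ℝ) ≤ L := one_le_of_affLinSize_le Ψ hΨ hL ⟨0, ht⟩
  have hN' : (1 : ℝ) ≤ N := by exact_mod_cast hN
  have hb0 : 0 ≤ Real.log (2 * L * N) := Real.log_nonneg (by nlinarith)
  simp only [Nat.sub_self, pow_zero, mul_one] at hβ hγ
  refine hS.trans (mul_le_mul_of_nonneg_left ?_ (pow_nonneg hb0 t))
  linarith

/-! ### The sieve remainder, crudely -/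

/-- **`∑_{d ≤ D squarefree} ω_F(d) ≤ ⌊D⌋²`** (`ω_F(d) ≤ d ≤ ⌊D⌋`, at most `⌊D⌋` moduli). [folklore] -/
theorem sum_rootCount_le_sq (F : Polynomial ℤ) (D : ℝ) :
    ∑ d ∈ (Icc 1 ⌊D⌋₊).filter Squarefree, (polyRootCountMod ![F] d : ℝ) ≤ (⌊D⌋₊ : ℝ) ^ 2 := by
  calc ∑ d ∈ (Icc 1 ⌊D⌋₊).filter Squarefree, (polyRootCountMod ![F] d : ℝ)
      ≤ ∑ d ∈ (Icc 1 ⌊D⌋₊).filter Squarefree, (⌊D⌋₊ : ℝ) := by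
        refine Finset.sum_le_sum fun d hd => ?_
        have hdD : d ≤ ⌊D⌋₊ := (Finset.mem_Icc.mp (Finset.mem_filter.mp hd).1).2
        exact_mod_cast (polyRootCountMod_le _ d).trans hdD
    _ = #((Icc 1 ⌊D⌋₊).filter Squarefree) * (⌊D⌋₊ : ℝ) := by rw [Finset.sum_const, nsmul_eq_mul]
    _ ≤ (⌊D⌋₊ : ℝ) * ⌊D⌋₊ := by
        have : #((Icc 1 ⌊D⌋₊).filter Squarefree) ≤ ⌊D⌋₊ :=
          (Finset.card_filter_le _ _).trans (by simp)
        exact mul_le_mul_of_nonneg_right (by exact_mod_cast this) (Nat.cast_nonneg _)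
    _ = (⌊D⌋₊ : ℝ) ^ 2 := by ring

/-! ### Assembly of the main term -/

/-- **Assembly of the sieve main term.**  With `C ≥ 0`, `#I ≤ β_∞ + 1`, `β_∞, 𝔖, W, b ≥ 0`, `0 ≤ V ≤ 1`,
`V ≤ 2 𝔖 W^t` and `b W ≤ 34`:  `b^t ((1 + C) #I V) ≤ 2 (1 + C) 34^t (β_∞ 𝔖) + (1 + C) b^t`. [folklore] -/
theorem upper_assembly {C I AF SP V W b : ℝ} (hC : 0 ≤ C) (hI : I ≤ AF + 1) (hAF : 0 ≤ AF)
    (hSP : 0 ≤ SP) (hW : 0 ≤ W) (hb : 0 ≤ b) (hV0 : 0 ≤ V) (hV1 : V ≤ 1) (hV : V ≤ 2 * SP * W ^ t)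
    (hbW : b * W ≤ 34) :
    b ^ t * ((1 + C) * I * V) ≤ 2 * (1 + C) * 34 ^ t * (AF * SP) + (1 + C) * b ^ t := by
  have hbt : 0 ≤ b ^ t := pow_nonneg hb t
  have hbWt : (b * W) ^ t ≤ 34 ^ t := pow_le_pow_left₀ (mul_nonneg hb hW) hbW t
  have h1 : (1 + C) * I * V ≤ (1 + C) * (AF + 1) * V := by
    have := mul_le_mul_of_nonneg_left hI (show 0 ≤ 1 + C by positivity)
    exact mul_le_mul_of_nonneg_right this hV0
  have h2 : (1 + C) * AF * V ≤ (1 + C) * AF * (2 * SP * W ^ t) :=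
    mul_le_mul_of_nonneg_left hV (by positivity)
  have h3 : (1 + C) * V ≤ 1 + C := mul_le_of_le_one_right (by positivity) hV1
  have h4 : (1 + C) * I * V ≤ (1 + C) * AF * (2 * SP * W ^ t) + (1 + C) := by nlinarith
  have h5 : b ^ t * ((1 + C) * AF * (2 * SP * W ^ t)) = 2 * (1 + C) * (AF * SP) * (b * W) ^ t := by
    rw [mul_pow]; ring
  have h6 : 2 * (1 + C) * (AF * SP) * (b * W) ^ t ≤ 2 * (1 + C) * (AF * SP) * 34 ^ t :=
    mul_le_mul_of_nonneg_left hbWt (by positivity)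
  calc b ^ t * ((1 + C) * I * V) ≤ b ^ t * ((1 + C) * AF * (2 * SP * W ^ t) + (1 + C)) :=
        mul_le_mul_of_nonneg_left h4 hbt
    _ = 2 * (1 + C) * (AF * SP) * (b * W) ^ t + (1 + C) * b ^ t := by rw [mul_add, h5]; ring
    _ ≤ 2 * (1 + C) * 34 ^ t * (AF * SP) + (1 + C) * b ^ t := by linarith

/-! ### The junk terms -/

/-- **The junk is `o(N)`**: for fixed `t, L, C` and `ε > 0`, eventually in `N`,
`log^t(2LN) · ((1+C) + ⌊N^{1/8}⌋² + 2t(2N^{1/17} + 1) + t √(2LN) log₂(2LN)) ≤ ε N`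
(every bracketed term is `O(√N log N)`, and `(log N)^{t+1} √N = o(N)`). [folklore] -/
theorem eventually_junk_le (t L : ℕ) {C : ℝ} (hC : 0 ≤ C) {ε : ℝ} (hε : 0 < ε) :
    ∀ᶠ N : ℕ in atTop, Real.log (2 * L * N) ^ t *
        ((1 + C) + (⌊(N : ℝ) ^ ((1 : ℝ) / 8)⌋₊ : ℝ) ^ 2 + 2 * t * (2 * (N : ℝ) ^ ((1 : ℝ) / 17) + 1) +
          t * ((Nat.sqrt (2 * L * N) : ℝ) * (Nat.log 2 (2 * L * N) : ℝ))) ≤ ε * N := by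
  set A : ℝ := 2 + C + 6 * t + 8 * t * Real.sqrt (2 * L) with hA
  have hA0 : 0 ≤ A := by rw [hA]; positivity
  have hmain := eventually_mul_log_pow_le_rpow (t + 1) (2 ^ t * A / ε) (1 / 2) (by norm_num)
  filter_upwards [hmain, eventually_ge_atTop (max (2 * L) 16)] with N hN hN16
  have hN2L : 2 * L ≤ N := le_of_max_le_left hN16
  have hN16' : (16 : ℝ) ≤ N := by exact_mod_cast le_of_max_le_right hN16
  have hNpos : (0 : ℝ) < N := by linarith
  have hN1 : (1 : ℝ) ≤ N := by linarith
  have hlogN1 : 1 ≤ Real.log N := by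
    rw [Real.le_log_iff_exp_le hNpos]
    have := Real.exp_one_lt_d9; linarith
  have hlogN0 : 0 ≤ Real.log N := by linarith
  -- `√N` and the small powers
  set S : ℝ := (N : ℝ) ^ ((1 : ℝ) / 2) with hS
  have hS1 : 1 ≤ S := Real.one_le_rpow hN1 (by norm_num)
  have hS0 : 0 ≤ S := by linarith
  have hSS : S * S = N := by
    rw [hS, ← Real.rpow_add hNpos]; norm_num
  have h17 : (N : ℝ) ^ ((1 : ℝ) / 17) ≤ S :=
    Real.rpow_le_rpow_of_exponent_le hN1 (by norm_num)
  have h8 : (⌊(N : ℝ) ^ ((1 : ℝ) / 8)⌋₊ : ℝ) ^ 2 ≤ S := by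
    have hf : (⌊(N : ℝ) ^ ((1 : ℝ) / 8)⌋₊ : ℝ) ≤ (N : ℝ) ^ ((1 : ℝ) / 8) := Nat.floor_le (by positivity)
    have hq : ((N : ℝ) ^ ((1 : ℝ) / 8)) ^ 2 = (N : ℝ) ^ ((1 : ℝ) / 4) := by
      rw [← Real.rpow_natCast, ← Real.rpow_mul hNpos.le]; norm_num
    calc (⌊(N : ℝ) ^ ((1 : ℝ) / 8)⌋₊ : ℝ) ^ 2 ≤ ((N : ℝ) ^ ((1 : ℝ) / 8)) ^ 2 :=
          pow_le_pow_left₀ (Nat.cast_nonneg _) hf 2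
      _ = (N : ℝ) ^ ((1 : ℝ) / 4) := hq
      _ ≤ S := Real.rpow_le_rpow_of_exponent_le hN1 (by norm_num)
  -- the case `L = 0` is degenerate but harmless: all bounds below hold with `L = 0` too
  have hL0 : (0 : ℝ) ≤ L := Nat.cast_nonneg L
  -- `log(2LN) ≤ 2 log N`
  have hlog2LN : Real.log (2 * L * N) ≤ 2 * Real.log N := by
    rcases Nat.eq_zero_or_pos L with hL | hL
    · subst hL; simp; linarith
    · have h2L : (1 : ℝ) ≤ 2 * L := by
        have : (1 : ℝ) ≤ L := by exact_mod_cast hL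
        linarith
      have h2LN : (2 * L : ℝ) ≤ N := by exact_mod_cast hN2L
      calc Real.log (2 * L * N) = Real.log (2 * L) + Real.log N := by
            rw [Real.log_mul (by positivity) (by positivity)]
        _ ≤ Real.log N + Real.log N := by
            have := Real.log_le_log (by positivity) h2LN
            linarith
        _ = 2 * Real.log N := by ring
  have hlog2LN0 : 0 ≤ Real.log (2 * L * N) := by
    rcases Nat.eq_zero_or_pos L with hL | hL
    · subst hL; simp
    · refine Real.log_nonneg ?_
      have : (1 : ℝ) ≤ L := by exact_mod_cast hL
      nlinarith
  -- `Nat.sqrt (2LN) ≤ √(2L) S` and `Nat.log 2 (2LN) ≤ 4 log N`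
  have hsqrt : (Nat.sqrt (2 * L * N) : ℝ) ≤ Real.sqrt (2 * L) * S := by
    have h1 : (Nat.sqrt (2 * L * N) : ℝ) ≤ Real.sqrt ((2 * L * N : ℕ) : ℝ) := Real.nat_sqrt_le_real_sqrt
    have h2 : Real.sqrt ((2 * L * N : ℕ) : ℝ) = Real.sqrt (2 * L) * S := by
      push_cast
      rw [Real.sqrt_mul (by positivity), hS, Real.sqrt_eq_rpow (N : ℝ)]
    linarith [h2.le]
  have hnatlog : (Nat.log 2 (2 * L * N) : ℝ) ≤ 4 * Real.log N := by
    rcases Nat.eq_zero_or_pos L with hL | hL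
    · subst hL; simp; linarith
    · have hM : 1 ≤ 2 * L * N := by
        have : 1 ≤ N := by exact_mod_cast hN1
        nlinarith
      have := Literature.NumberTheory.LFunctions.HuxleyZeroDensity.natLog_two_le (2 * L * N) hM
      push_cast at this
      linarith
  -- the bracket is `≤ A · log N · S`
  have ht0 : (0 : ℝ) ≤ t := Nat.cast_nonneg t
  have hbr : (1 + C) + (⌊(N : ℝ) ^ ((1 : ℝ) / 8)⌋₊ : ℝ) ^ 2 + 2 * t * (2 * (N : ℝ) ^ ((1 : ℝ) / 17) + 1) +
      t * ((Nat.sqrt (2 * L * N) : ℝ) * (Nat.log 2 (2 * L * N) : ℝ)) ≤ A * Real.log N * S := by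
    have e1 : (1 + C) ≤ (1 + C) * Real.log N * S := by
      have h1 : (1 : ℝ) ≤ Real.log N * S := by nlinarith
      have h0 : 0 ≤ 1 + C := by linarith
      nlinarith
    have e2 : (⌊(N : ℝ) ^ ((1 : ℝ) / 8)⌋₊ : ℝ) ^ 2 ≤ 1 * Real.log N * S := by nlinarith
    have e3 : 2 * t * (2 * (N : ℝ) ^ ((1 : ℝ) / 17) + 1) ≤ 6 * t * Real.log N * S := by
      have : 2 * (N : ℝ) ^ ((1 : ℝ) / 17) + 1 ≤ 3 * S := by linarith
      calc 2 * t * (2 * (N : ℝ) ^ ((1 : ℝ) / 17) + 1) ≤ 2 * t * (3 * S) :=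
            mul_le_mul_of_nonneg_left this (by positivity)
        _ = 6 * t * S * 1 := by ring
        _ ≤ 6 * t * S * Real.log N := mul_le_mul_of_nonneg_left hlogN1 (by positivity)
        _ = 6 * t * Real.log N * S := by ring
    have e4 : t * ((Nat.sqrt (2 * L * N) : ℝ) * (Nat.log 2 (2 * L * N) : ℝ)) ≤
        8 * t * Real.sqrt (2 * L) * Real.log N * S := by
      have hx : (Nat.sqrt (2 * L * N) : ℝ) * (Nat.log 2 (2 * L * N) : ℝ) ≤
          (Real.sqrt (2 * L) * S) * (4 * Real.log N) :=
        mul_le_mul hsqrt hnatlog (Nat.cast_nonneg _) (by positivity)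
      have hnn : 0 ≤ (t : ℝ) * Real.sqrt (2 * L) * Real.log N * S := by positivity
      calc t * ((Nat.sqrt (2 * L * N) : ℝ) * (Nat.log 2 (2 * L * N) : ℝ))
          ≤ t * ((Real.sqrt (2 * L) * S) * (4 * Real.log N)) := mul_le_mul_of_nonneg_left hx ht0
        _ = 4 * (t * Real.sqrt (2 * L) * Real.log N * S) := by ring
        _ ≤ 8 * (t * Real.sqrt (2 * L) * Real.log N * S) := by linarith
        _ = 8 * t * Real.sqrt (2 * L) * Real.log N * S := by ring
    calc (1 + C) + (⌊(N : ℝ) ^ ((1 : ℝ) / 8)⌋₊ : ℝ) ^ 2 + 2 * t * (2 * (N : ℝ) ^ ((1 : ℝ) / 17) + 1) +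
          t * ((Nat.sqrt (2 * L * N) : ℝ) * (Nat.log 2 (2 * L * N) : ℝ))
        ≤ (1 + C) * Real.log N * S + 1 * Real.log N * S + 6 * t * Real.log N * S +
            8 * t * Real.sqrt (2 * L) * Real.log N * S := by linarith
      _ = A * Real.log N * S := by rw [hA]; ring
  -- conclude
  have hlogt : Real.log (2 * L * N) ^ t ≤ 2 ^ t * Real.log N ^ t := by
    rw [← mul_pow]; exact pow_le_pow_left₀ hlog2LN0 hlog2LN t
  have hmain' : 2 ^ t * A * Real.log N ^ (t + 1) ≤ ε * S := by
    have h := mul_le_mul_of_nonneg_left hN hε.le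
    have e : ε * (2 ^ t * A / ε * Real.log N ^ (t + 1)) = 2 ^ t * A * Real.log N ^ (t + 1) := by
      field_simp
    rw [e] at h
    rwa [hS]
  calc Real.log (2 * L * N) ^ t * ((1 + C) + (⌊(N : ℝ) ^ ((1 : ℝ) / 8)⌋₊ : ℝ) ^ 2 +
        2 * t * (2 * (N : ℝ) ^ ((1 : ℝ) / 17) + 1) +
          t * ((Nat.sqrt (2 * L * N) : ℝ) * (Nat.log 2 (2 * L * N) : ℝ)))
      ≤ (2 ^ t * Real.log N ^ t) * (A * Real.log N * S) := by
        refine mul_le_mul hlogt hbr ?_ (by positivity)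
        -- the bracket is non-negative up to `C`; use the bound `hbr`'s left side ≥ ... via transitivity
        have := Real.rpow_nonneg hNpos.le ((1 : ℝ) / 17)
        positivity
    _ = (2 ^ t * A * Real.log N ^ (t + 1)) * S := by ring
    _ ≤ (ε * S) * S := mul_le_mul_of_nonneg_right hmain' hS0
    _ = ε * N := by rw [mul_assoc, hSS]

end Summit.Parity.GeneralizedHardyLittlewood.TwinLowerDensityToGHLUniformUpperBound
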